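import Summits.ResolutionOfSingularities.ResolutionOfSingularities.Theorems.PurelyInseparableDim4EquimultipleScope
import Summits.ResolutionOfSingularities.ResolutionOfSingularities.Theorems.PurelyInseparableDim4IsolationConverse
import Literature.AlgebraicGeometry.Resolution.OrdZeroBasics
import Literature.RingTheory.MvPolynomial.IdealOfVarsBasics
import HarnessLib
import HarnessLib.Audit.Tags

/-!
# Purely inseparable four-folds — the isolation predicate, the `q`-fold locus ideal and `ord₀` are
# invariant under origin-fixing coordinate changes (cell `res-dim4-pi`, K2(p) lane, brick (ii) FILE A)

[OURS · counted 0 · cell `res-dim4-pi` · desk WORD #76 (ii), seat res-dim4-p-11 g2.]  Nothing here proves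
K2(p), `NoIsolatedTrap p p` or resolution of singularities in dimension ≥ 4 / characteristic `p`.

The frame's predicates are stated in the fixed coordinates `x₁, …, x₄` of `K[x₁, …, x₄]`
(`PIDim4.singLocusIdeal q F = ⟨D^{(α)} F : 0 < |α| < q⟩`, `PIDim4.IsIsolated q F`, `Hauser2010.ordZero`).
idea-4's W-frame / Tschirnhaus straightening (CARD I-4-7 (TS), memo E2-WINDOW (A2)/(A3)) changes these
coordinates.  This file proves, once and for every `K`-algebra endomorphism / automorphism of
`K[x₁, …, x₄]`, that nothing is lost:

* §1 `taylor_aeval` — the Taylor morphism of a composite: `(F∘g)(x + u) = F(g(x) + δ(u))` with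
  `δᵢ = gᵢ(x + u) − gᵢ(x) ∈ (u)`; hence `hasseDeriv_aeval_mem_span`: **`D^{(α)}(F∘g)` lies in the ideal
  spanned by the `(D^{(β)}F)∘g`, `0 < |β| ≤ |α|`** (every characteristic — the Hasse–Schmidt operators of
  order `≤ n` are functorial), and `singLocusIdeal_aeval_le`:
  `J_q⁺(F∘g) ≤ J_q⁺(F)·K[x]` (extension along `g`); for an automorphism EQUALITY (`singLocusIdeal_algEquiv`).
* §2 `ordZero_algEquiv` — an origin-fixing automorphism preserves `ord₀` (it preserves every `𝔪₀ⁿ`).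
* §3 `isIsolated_algEquiv_iff` — **an origin-fixing automorphism preserves `IsIsolated q`** (transport of
  the isolation certificate `𝔪₀ᴺ ≤ J_q⁺ + 𝔪₀ᴺ⁺¹` of `…IsolationConverse`).

FILE B (`…UnipotentStep`) specialises to the one move the W-frame uses, `x_k ↦ x_k + φ(x_{≠k})`, and its
dictionary with `CentreBlowup.step`.  bears_on: LADDER-RESOLUTION:D157-DOOR2 (res-dim4-pi · K2(p) · (ii)).
Supports stmt-ResolutionOfSingularities-16155 (helper).
-/

set_option linter.dupNamespace false -- mandated namespace of this single-conjunct summit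

noncomputable section

namespace Summit.ResolutionOfSingularities.ResolutionOfSingularities.Theorems.PIDim4

namespace CoordChange

open MvPolynomial Finset
open Literature.AlgebraicGeometry
open Literature.AlgebraicGeometry.Resolution
open Literature.AlgebraicGeometry.Resolution.Hauser2010

variable {K : Type} [Field K]

/-! ## 1. Hasse–Schmidt derivatives of a composite -/

/-- **Taylor morphism of a composite.**  For a substitution `g` (`xᵢ ↦ gᵢ`),
`(F∘g)(x + u) = F(g(x) + δ(u))` where `δᵢ := gᵢ(x + u) − gᵢ(x)`: both sides are `K`-algebra maps
`K[x] → K[x][u]` agreeing on the variables. [cite: VillamayorU2008ReesDiff, §2.6 (Tay : B → B[U])] [folklore] -/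
theorem taylor_aeval (g : Fin 4 → MvPolynomial (Fin 4) K) (F : MvPolynomial (Fin 4) K) :
    taylor K (aeval g F) =
      aeval (fun i => taylor K (g i) - C (g i))
        (MvPolynomial.map (aeval g).toRingHom (taylor K F)) := by
  let L₁ : MvPolynomial (Fin 4) K →ₐ[K] MvPolynomial (Fin 4) (MvPolynomial (Fin 4) K) :=
    (taylor K).comp (aeval g)
  let L₂ : MvPolynomial (Fin 4) K →ₐ[K] MvPolynomial (Fin 4) (MvPolynomial (Fin 4) K) :=
    ((aeval fun i => taylor K (g i) - C (g i)).restrictScalars K).comp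
      ((mapAlgHom (aeval g)).comp (taylor K))
  have h : L₁ = L₂ := by
    refine MvPolynomial.algHom_ext fun i => ?_
    simp only [L₁, L₂, AlgHom.comp_apply, AlgHom.coe_restrictScalars', aeval_X, taylor_X,
      mapAlgHom_apply, map_add, map_C, map_X, aeval_C, algebraMap_eq]
    rw [show ((aeval g : MvPolynomial (Fin 4) K →ₐ[K] MvPolynomial (Fin 4) K) :
        MvPolynomial (Fin 4) K →+* MvPolynomial (Fin 4) K) (X i) = g i from aeval_X g i]
    ring
  have h' := congrArg (fun L => L F) h
  simpa [L₁, L₂] using h'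

/-- The increments `δᵢ = gᵢ(x + u) − gᵢ(x)` have no `u`-constant term. [folklore] -/
theorem constantCoeff_taylor_sub_C (P : MvPolynomial (Fin 4) K) :
    constantCoeff (taylor K P - C P) = 0 := by
  have h := RingHom.congr_fun (constantCoeff_comp_taylor K (σ := Fin 4)) P
  rw [RingHom.comp_apply, RingHom.id_apply] at h
  rw [map_sub, constantCoeff_C]
  exact sub_eq_zero.mpr h

/-- Substituting the increments into `u^β` produces only monomials of degree `≥ |β|`: the coefficient of
`u^α` vanishes for `|α| < |β|`. [folklore] -/
theorem coeff_aeval_monomial_eq_zero (g : Fin 4 → MvPolynomial (Fin 4) K) {α β : Fin 4 →₀ ℕ}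
    (h : α.degree < β.degree) (c : MvPolynomial (Fin 4) K) :
    coeff α (aeval (fun i => taylor K (g i) - C (g i)) (monomial β c)) = 0 := by
  have hmem : aeval (fun i => taylor K (g i) - C (g i)) (monomial β c) ∈
      MvPolynomial.idealOfVars (Fin 4) (MvPolynomial (Fin 4) K) ^ β.degree :=
    Literature.RingTheory.MvPolynomial.aeval_mem_idealOfVars_pow _
      (fun i => constantCoeff_taylor_sub_C (g i))
      (Literature.RingTheory.MvPolynomial.monomial_mem_idealOfVars_pow_of_le le_rfl c)
  exact Literature.RingTheory.MvPolynomial.coeff_eq_zero_of_mem_idealOfVars_pow hmem h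

/-- **Hasse–Schmidt derivatives of a composite**: for `α ≠ 0`, `D^{(α)}(F∘g)` lies in the ideal spanned
by the `(D^{(β)}F)∘g` with `0 < |β| ≤ |α|` (the `u^α`-coefficient of `F(g(x) + δ(u))`, `δ ∈ (u)`).
[cite: EGAIV4, Prop. 16.8.8 (functoriality of differential operators of order ≤ n)] [folklore] -/
theorem hasseDeriv_aeval_mem_span (g : Fin 4 → MvPolynomial (Fin 4) K) (F : MvPolynomial (Fin 4) K)
    {α : Fin 4 →₀ ℕ} (hα : α ≠ 0) :
    Resolution.hasseDeriv K α (aeval g F) ∈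
      Ideal.span {H | ∃ β : Fin 4 →₀ ℕ, 0 < β.degree ∧ β.degree ≤ α.degree ∧
        H = aeval g (Resolution.hasseDeriv K β F)} := by
  classical
  rw [hasseDeriv_apply, taylor_aeval]
  rw [(taylor K F).as_sum, map_sum, map_sum, coeff_sum]
  refine Ideal.sum_mem _ fun β _ => ?_
  rw [map_monomial]
  by_cases hdeg : α.degree < β.degree
  · rw [coeff_aeval_monomial_eq_zero g hdeg]
    exact Ideal.zero_mem _
  by_cases hβ0 : β = 0
  · subst hβ0
    rw [monomial_zero', aeval_C, algebraMap_eq, coeff_C, if_neg (Ne.symm hα)]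
    exact Ideal.zero_mem _
  · -- `aeval δ (monomial β c) = C c * δ^β`, coefficient `= c * coeff α (δ^β)`
    rw [show monomial β ((aeval g).toRingHom (coeff β (taylor K F))) =
        C ((aeval g).toRingHom (coeff β (taylor K F))) * monomial β 1 by
          rw [C_mul_monomial, mul_one], map_mul, aeval_C, algebraMap_eq, coeff_C_mul]
    refine Ideal.mul_mem_right _ _ (Ideal.subset_span ⟨β, ?_, not_lt.mp hdeg, ?_⟩)
    · exact Nat.pos_of_ne_zero fun h => hβ0 ((Finsupp.degree_eq_zero_iff β).mp h)
    · rfl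

/-- **`J_q⁺(F∘g) ≤ J_q⁺(F)·K[x]`**: the `q`-fold-locus ideal of a composite lies in the extension of that of
`F` along the substitution. [cite: EGAIV4, Prop. 16.8.8] [folklore] -/
theorem singLocusIdeal_aeval_le (q : ℕ) (g : Fin 4 → MvPolynomial (Fin 4) K) (F : MvPolynomial (Fin 4) K) :
    singLocusIdeal q (aeval g F) ≤ (singLocusIdeal q F).map (aeval g).toRingHom := by
  rw [Equimultiple.singLocusIdeal_eq_span, Equimultiple.singLocusIdeal_eq_span, Ideal.span_le]
  rintro _ ⟨α, hα0, hαq, rfl⟩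
  have hα : α ≠ 0 := fun h => by rw [h, map_zero] at hα0; exact lt_irrefl 0 hα0
  refine (Ideal.span_le.mpr ?_) (hasseDeriv_aeval_mem_span g F hα)
  rintro _ ⟨β, hβ0, hβle, rfl⟩
  exact Ideal.mem_map_of_mem _ (Ideal.subset_span ⟨β, hβ0, lt_of_le_of_lt hβle hαq, rfl⟩)

/-- An algebra automorphism of `K[x₁..x₄]` is the substitution of its values on the variables. [folklore] -/
theorem algEquiv_eq_aeval (τ : MvPolynomial (Fin 4) K ≃ₐ[K] MvPolynomial (Fin 4) K)
    (F : MvPolynomial (Fin 4) K) : τ F = aeval (fun i => τ (X i)) F := by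
  have h : (τ : MvPolynomial (Fin 4) K →ₐ[K] MvPolynomial (Fin 4) K) = aeval fun i => τ (X i) :=
    MvPolynomial.algHom_ext fun i => by rw [aeval_X]; rfl
  exact congrArg (fun L : MvPolynomial (Fin 4) K →ₐ[K] MvPolynomial (Fin 4) K => L F) h

/-- The ring-hom underlying an automorphism is the substitution of its values. [folklore] -/
theorem coe_algEquiv_eq_aeval (τ : MvPolynomial (Fin 4) K ≃ₐ[K] MvPolynomial (Fin 4) K) :
    (τ : MvPolynomial (Fin 4) K →+* MvPolynomial (Fin 4) K) =
      (aeval fun i => τ (X i) : MvPolynomial (Fin 4) K →ₐ[K] MvPolynomial (Fin 4) K).toRingHom :=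
  RingHom.ext fun G => algEquiv_eq_aeval τ G

/-- `τ ∘ τ⁻¹ = id` on the underlying ring-homs. [folklore] -/
theorem coe_comp_coe_symm (τ : MvPolynomial (Fin 4) K ≃ₐ[K] MvPolynomial (Fin 4) K) :
    (τ : MvPolynomial (Fin 4) K →+* MvPolynomial (Fin 4) K).comp
      (τ.symm : MvPolynomial (Fin 4) K →+* MvPolynomial (Fin 4) K) = RingHom.id _ :=
  RingHom.ext fun G => τ.apply_symm_apply G

/-- **`J_q⁺(τ F) = τ(J_q⁺(F))`** for a `K`-algebra automorphism `τ` of `K[x₁..x₄]`.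
[cite: EGAIV4, Prop. 16.8.8] [folklore] -/
theorem singLocusIdeal_algEquiv (q : ℕ) (τ : MvPolynomial (Fin 4) K ≃ₐ[K] MvPolynomial (Fin 4) K)
    (F : MvPolynomial (Fin 4) K) :
    singLocusIdeal q (τ F) =
      (singLocusIdeal q F).map (τ : MvPolynomial (Fin 4) K →+* MvPolynomial (Fin 4) K) := by
  refine le_antisymm ?_ ?_
  · rw [algEquiv_eq_aeval, coe_algEquiv_eq_aeval]
    exact singLocusIdeal_aeval_le q _ F
  · -- apply `≤` to `τ⁻¹` and `τ F`, then map forward along `τ`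
    have h1 : singLocusIdeal q F ≤
        (singLocusIdeal q (τ F)).map (τ.symm : MvPolynomial (Fin 4) K →+* MvPolynomial (Fin 4) K) := by
      have h := singLocusIdeal_aeval_le q (fun i => τ.symm (X i)) (τ F)
      rwa [← algEquiv_eq_aeval τ.symm (τ F), τ.symm_apply_apply, ← coe_algEquiv_eq_aeval] at h
    have h2 := Ideal.map_mono (f := (τ : MvPolynomial (Fin 4) K →+* MvPolynomial (Fin 4) K)) h1
    rwa [Ideal.map_map, coe_comp_coe_symm, Ideal.map_id] at h2

/-! ## 2. `ord₀` under an origin-fixing automorphism -/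

/-- An origin-fixing substitution does not lower `ord₀`. [folklore] -/
theorem ordZero_le_ordZero_aeval (g : Fin 4 → MvPolynomial (Fin 4) K) (hg : ∀ i, constantCoeff (g i) = 0)
    (F : MvPolynomial (Fin 4) K) : ordZero F ≤ ordZero (aeval g F) := by
  by_cases hF : F = 0
  · rw [hF, map_zero]
  · obtain ⟨n, hn⟩ := exists_ordZero_eq_natCast hF
    rw [hn, natCast_le_ordZero_iff_mem_idealOfVars_pow]
    exact Literature.RingTheory.MvPolynomial.aeval_mem_idealOfVars_pow g hg
      ((natCast_le_ordZero_iff_mem_idealOfVars_pow F n).mp hn.symm.le)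

/-- An origin-fixing substitution does not change the constant term. [folklore] -/
theorem constantCoeff_aeval_of_origin (g : Fin 4 → MvPolynomial (Fin 4) K)
    (hg : ∀ i, constantCoeff (g i) = 0) (P : MvPolynomial (Fin 4) K) :
    constantCoeff (aeval g P) = constantCoeff P := by
  have h : (constantCoeff : MvPolynomial (Fin 4) K →+* K).comp (aeval g).toRingHom =
      (constantCoeff : MvPolynomial (Fin 4) K →+* K) := by
    refine MvPolynomial.ringHom_ext (fun c => ?_) (fun i => ?_)
    · simp
    · simp [hg i]
  exact RingHom.congr_fun h P

/-- The inverse of an origin-fixing automorphism fixes the origin. [folklore] -/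
theorem constantCoeff_symm_X (τ : MvPolynomial (Fin 4) K ≃ₐ[K] MvPolynomial (Fin 4) K)
    (hτ : ∀ i, constantCoeff (τ (X i)) = 0) (i : Fin 4) : constantCoeff (τ.symm (X i)) = 0 := by
  -- `xᵢ = τ(τ⁻¹ xᵢ)` has the constant term of `τ⁻¹ xᵢ` (τ fixes the origin), and that of `xᵢ` is `0`.
  have h1 : constantCoeff (τ (τ.symm (X i))) = constantCoeff (τ.symm (X i)) := by
    rw [algEquiv_eq_aeval τ]
    exact constantCoeff_aeval_of_origin _ hτ _
  rw [τ.apply_symm_apply, constantCoeff_X] at h1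
  exact h1.symm

/-- **An origin-fixing automorphism preserves `ord₀`.** [folklore] -/
theorem ordZero_algEquiv (τ : MvPolynomial (Fin 4) K ≃ₐ[K] MvPolynomial (Fin 4) K)
    (hτ : ∀ i, constantCoeff (τ (X i)) = 0) (F : MvPolynomial (Fin 4) K) :
    ordZero (τ F) = ordZero F := by
  refine le_antisymm ?_ ?_
  · have h := ordZero_le_ordZero_aeval (fun i => τ.symm (X i)) (constantCoeff_symm_X τ hτ) (τ F)
    rwa [← algEquiv_eq_aeval, τ.symm_apply_apply] at h
  · have h := ordZero_le_ordZero_aeval (fun i => τ (X i)) hτ F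
    rwa [← algEquiv_eq_aeval] at h

/-! ## 3. Isolation under an origin-fixing automorphism -/

/-- An origin-fixing automorphism maps `𝔪₀` into `𝔪₀`. [folklore] -/
theorem map_originIdeal_le (τ : MvPolynomial (Fin 4) K ≃ₐ[K] MvPolynomial (Fin 4) K)
    (hτ : ∀ i, constantCoeff (τ (X i)) = 0) :
    (originIdeal K).map (τ : MvPolynomial (Fin 4) K →+* MvPolynomial (Fin 4) K) ≤ originIdeal K := by
  rw [IsolationCert.originIdeal_eq_idealOfVars, coe_algEquiv_eq_aeval]
  exact Literature.RingTheory.MvPolynomial.map_aeval_idealOfVars_le _ hτ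

/-- An origin-fixing automorphism maps `𝔪₀` onto `𝔪₀`. [folklore] -/
theorem map_originIdeal_algEquiv (τ : MvPolynomial (Fin 4) K ≃ₐ[K] MvPolynomial (Fin 4) K)
    (hτ : ∀ i, constantCoeff (τ (X i)) = 0) :
    (originIdeal K).map (τ : MvPolynomial (Fin 4) K →+* MvPolynomial (Fin 4) K) = originIdeal K := by
  refine le_antisymm (map_originIdeal_le τ hτ) ?_
  -- `𝔪₀ = τ(τ⁻¹ 𝔪₀) ≤ τ(𝔪₀)`
  have h := Ideal.map_mono (f := (τ : MvPolynomial (Fin 4) K →+* MvPolynomial (Fin 4) K))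
    (map_originIdeal_le τ.symm (constantCoeff_symm_X τ hτ))
  rwa [Ideal.map_map, coe_comp_coe_symm, Ideal.map_id] at h

/-- One direction of the transport: isolation of `F` gives isolation of `τ F`. [folklore] -/
theorem isIsolated_algEquiv {q : ℕ} (τ : MvPolynomial (Fin 4) K ≃ₐ[K] MvPolynomial (Fin 4) K)
    (hτ : ∀ i, constantCoeff (τ (X i)) = 0) {F : MvPolynomial (Fin 4) K} (h : IsIsolated q F) :
    IsIsolated q (τ F) := by
  obtain ⟨N, hN⟩ := IsolationConverse.exists_certificate_of_isIsolated h
  refine IsolationCert.isIsolated_of_pow_le_sup_pow_succ ?_ (N := N) ?_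
  · rw [singLocusIdeal_algEquiv, ← map_originIdeal_algEquiv τ hτ]
    exact Ideal.map_mono h.1
  · have h' := Ideal.map_mono (f := (τ : MvPolynomial (Fin 4) K →+* MvPolynomial (Fin 4) K)) hN
    rwa [Ideal.map_sup, Ideal.map_pow, Ideal.map_pow, map_originIdeal_algEquiv τ hτ,
      ← singLocusIdeal_algEquiv] at h'

/-- **Isolation is invariant under origin-fixing coordinate changes**: for a `K`-algebra automorphism `τ`
of `K[x₁..x₄]` with `τ(xᵢ)(0) = 0`, the origin is an isolated `q`-fold point of `z^q + τF` iff it is one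
of `z^q + F`. [folklore] -/
theorem isIsolated_algEquiv_iff (q : ℕ) (τ : MvPolynomial (Fin 4) K ≃ₐ[K] MvPolynomial (Fin 4) K)
    (hτ : ∀ i, constantCoeff (τ (X i)) = 0) (F : MvPolynomial (Fin 4) K) :
    IsIsolated q (τ F) ↔ IsIsolated q F := by
  refine ⟨fun h => ?_, isIsolated_algEquiv τ hτ⟩
  have h' := isIsolated_algEquiv τ.symm (constantCoeff_symm_X τ hτ) h
  rwa [τ.symm_apply_apply] at h'

end CoordChange

end Summit.ResolutionOfSingularities.ResolutionOfSingularities.Theorems.PIDim4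

end
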